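import Literature.NumberTheory.LFunctions.GRHTwistedCharacterPrimeSumsBookkeeping
import HarnessLib

/-!
# Twisted prime sums under GRH (Montgomery–Vaughan §13.1, twisted): the bound for `ψ(x, χ, t)`

Topic `Literature/NumberTheory/LFunctions`. THEOREMS (everything proved). For a primitive
character `χ` mod `q > 1` whose `L`-function satisfies the Riemann hypothesis, the TWISTED
Chebyshev function obeys, uniformly in `q`, real `t` and `x ≥ 2`,

  **`|ψ(x, χ, t)| = |∑_{n ≤ x} χ(n) Λ(n) n^{-it}| ≤ A x^{1/2} (log x) log(q(|t| + 2)x)`**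

(`exists_norm_twistedPsi_le`), the `t`-uniform form of Montgomery–Vaughan (13.19) that feeds
Lagarias–Soundararajan's GRH bound for the partial Euler products `L(s, χ; y)`
(`GRHSmoothEulerProductLindelof.lean`). Only ONE factor `log(q(|t| + 2)x)` occurs; this is
essential downstream and is the reason for the averaging below.

Proof (files `GRHTwistedCharacterPrimeSums{Zeros,Remainder,Identity,Averages,Bookkeeping}.lean`): by
`GRHTwistedPrimeSum.norm_twistedSum_add_zeroSums_le` (Abel summation of the PROVED truncated
explicit formula, MV Thm. 12.10, with `T = (q(|t|+2)x)²`), for `X ∈ [x, x + √x]`,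
`c ∈ [9/4, 11/4]`, `‖S₃(X) + Z(X) − Z(c)‖ ≪ K(log x + log(q(|t|+2)x))`, where
`S₃(X) = ∑_{2 < n ≤ X} χ(n)Λ(n)n^{-it}` and `Z(y) = ∑_{|γ| ≤ T} m(ρ) y^{ρ-it}/(ρ − it)`;
`S₃(X) − S₃(x)` is trivially `≤ (√x + 1) log 2x`; averaging over `c` and over `X`
(`GRHTwistedPrimeSum.norm_add_avg_le`) replaces `Z(X)`, `Z(c)` by their averages, which under RH
are damped sums `≪ √x ∑ m(ρ) min(1/|ρ − it|, √x/|ρ − it|²)` resp. `≪ ∑ m(ρ) min(1/|w|, 1/|w|²)`,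
and these are `≪ (log q + log T)(1 + log x)` by the unit-window count MV Thm. 10.17
(`GRHTwistedPrimeSum.exists_sum_mul_min_le`). The bookkeeping is `GRHTwistedPrimeSum.norm_twistedPsi_arith`.

## References

* H. L. Montgomery, R. C. Vaughan, *Multiplicative Number Theory I. Classical Theory*, CUP 2007,
  §13.1, Theorem 13.7 (13.19) and its proof; Theorems 10.17, 12.10. [MontgomeryVaughan2007]
-/

noncomputable section

open Complex Filter Topology Set MeasureTheory intervalIntegral
open scoped Real ArithmeticFunction.vonMangoldt

namespace Literature.NumberTheory.LFunctions

namespace GRHTwistedPrimeSum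

open DirichletCharacter ExplicitPsiChar GRHPrimeCharSum

/-! ### The theorem -/

/-- **Twisted (13.19) under RH.** There is an absolute `A > 0` such that for every `q > 1`, every
primitive `χ` mod `q` whose `L`-function satisfies the Riemann hypothesis, every real `t` and
every `x ≥ 2`,
`‖∑_{n ≤ x} χ(n) Λ(n) n^{-it}‖ ≤ A x^{1/2} (log x) log(q(|t| + 2)x)`.
For `t = 0` this is Montgomery–Vaughan (13.19); the `t`-uniform version is what the
Lagarias–Soundararajan argument consumes. [cite: MontgomeryVaughan2007, Theorem 13.7 (13.19), proof] -/
theorem exists_norm_twistedPsi_le :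
    ∃ A : ℝ, 0 < A ∧ ∀ (q : ℕ) [NeZero q] (χ : DirichletCharacter ℂ q), χ.IsPrimitive → 1 < q →
      χ.RiemannHypothesis → ∀ (t x : ℝ), 2 ≤ x →
        ‖∑ n ∈ Finset.range (⌊x⌋₊ + 1), χ n * Λ n * (n : ℂ) ^ (-(t * I))‖ ≤
          A * Real.sqrt x * Real.log x * Real.log (q * (|t| + 2) * x) := by
  obtain ⟨K₀, hK₀⟩ := truncatedExplicitFormula_psiChar_holds 2 one_lt_two
  obtain ⟨C₂, hC₂0, hC₂⟩ := exists_sum_mul_min_le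
  set K : ℝ := max K₀ 0 with hKdef
  have hK0 : 0 ≤ K := le_max_right _ _
  have hEF : ∀ (q : ℕ) [NeZero q], 1 < q → ∀ χ : DirichletCharacter ℂ q, χ.IsPrimitive →
      ∀ y : ℝ, 2 ≤ y → ∀ T : ℝ, 2 ≤ T →
        ‖chebyshevPsiChar₀ χ y - (-charZeroSumTrunc χ y T - 1 / 2 * Real.log (y - 1) -
            χ (-1) / 2 * Real.log (y + 1) + explicitFormulaConst χ)‖ ≤
          K * (Real.log y * min 1 (y / (T * primePowDist y)) + y / T * Real.log (q * y * T) ^ 2) := by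
    intro q _ hq χ hprim y hy T hT
    refine (hK₀ q hq χ hprim y hy T hT).trans (mul_le_mul_of_nonneg_right (le_max_left _ _) ?_)
    have : 0 ≤ min 1 (y / (T * primePowDist y)) :=
      le_min zero_le_one (div_nonneg (by linarith) (mul_nonneg (by linarith) (primePowDist_nonneg y)))
    have : 0 ≤ Real.log y := Real.log_nonneg (by linarith)
    positivity
  refine ⟨6 * K + 73 * C₂ + 50, by positivity, fun q _ χ hprim hq hRH t x hx ↦ ?_⟩
  classical
  have hχ : χ ≠ 1 := ne_one_of_isPrimitive hprim hq
  have hx0 : 0 < x := by linarith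
  have hx1 : 1 ≤ x := by linarith
  have hq2 : (2 : ℝ) ≤ q := by exact_mod_cast hq
  have h2 : (0.6931471803 : ℝ) < Real.log 2 := Real.log_two_gt_d9
  -- the trivial range `x < 16`
  by_cases hx16 : x < 16
  · have hS : ‖∑ n ∈ Finset.range (⌊x⌋₊ + 1), χ n * Λ n * (n : ℂ) ^ (-(t * I))‖ ≤ 87 := by
      calc _ ≤ ∑ n ∈ Finset.range (⌊x⌋₊ + 1), ‖χ n * Λ n * (n : ℂ) ^ (-(t * I))‖ := norm_sum_le _ _
        _ ≤ ∑ n ∈ Finset.range (⌊x⌋₊ + 1), (Λ n : ℝ) := Finset.sum_le_sum fun n _ ↦ norm_twistTerm_le χ t n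
        _ = Chebyshev.psi x := by rw [Chebyshev.psi_eq_sum_Icc, Nat.range_succ_eq_Icc_zero]
        _ ≤ (Real.log 4 + 4) * x := Chebyshev.psi_le_const_mul_self hx0.le
        _ ≤ 87 := by nlinarith [log_four_lt]
    have hs : 1.41 ≤ Real.sqrt x := by
      rw [Real.le_sqrt (by norm_num) hx0.le]; nlinarith
    have hℓ : Real.log 2 ≤ Real.log x := Real.log_le_log two_pos hx
    have h4 : (2 : ℝ) * 2 ≤ q * (|t| + 2) := mul_le_mul hq2 (by linarith [abs_nonneg t]) (by norm_num) (by linarith)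
    have h8' : (2 : ℝ) * 2 * 2 ≤ q * (|t| + 2) * x := mul_le_mul h4 hx (by norm_num) (by positivity)
    have hL : Real.log 8 ≤ Real.log (q * (|t| + 2) * x) := Real.log_le_log (by norm_num) (by linarith)
    have h8 : Real.log 8 = 3 * Real.log 2 := by
      rw [show (8 : ℝ) = 2 ^ 3 by norm_num, Real.log_pow]; norm_num
    have hM : 2 ≤ Real.sqrt x * Real.log x * Real.log (q * (|t| + 2) * x) := by
      have h1 : 1.41 * 0.693 ≤ Real.sqrt x * Real.log x := mul_le_mul hs (by linarith) (by norm_num) (by linarith)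
      have h2 : 1.41 * 0.693 * 2.079 ≤ Real.sqrt x * Real.log x * Real.log (q * (|t| + 2) * x) :=
        mul_le_mul h1 (by linarith) (by norm_num) (by positivity)
      linarith
    have hA : 50 ≤ 6 * K + 73 * C₂ + 50 := by linarith [mul_nonneg (by norm_num : (0 : ℝ) ≤ 73) hC₂0.le]
    calc _ ≤ (87 : ℝ) := hS
      _ ≤ 50 * 2 := by norm_num
      _ ≤ (6 * K + 73 * C₂ + 50) * (Real.sqrt x * Real.log x * Real.log (q * (|t| + 2) * x)) :=
          mul_le_mul hA hM (by norm_num) (by positivity)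
      _ = _ := by ring
  -- the main range `x ≥ 16`
  push Not at hx16
  obtain ⟨hR64, -, -, hT2, -, -⟩ := T_facts (t := t) hq2 hx16
  obtain ⟨hs4, hℓ, hlog2x, -⟩ := log_facts hx16
  set s := Real.sqrt x with hs
  have hs0 : 0 < s := by linarith
  set T : ℝ := (q * (|t| + 2) * x) ^ 2 with hT
  have hT0 : 0 ≤ T := by positivity
  -- the zeros
  set P := (lfunctionZeroBox_finite hχ T).toFinset with hPdef
  have hP : ∀ ρ ∈ P, χ.LFunction ρ = 0 ∧ 0 < ρ.re ∧ ρ.re < 1 ∧ |ρ.im| ≤ T := fun ρ hρ ↦ by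
    simpa [hPdef, mem_lfunctionZeroBox] using hρ
  have hPre : ∀ ρ ∈ P, ρ.re = 1 / 2 := fun ρ hρ ↦ hRH ρ (hP ρ hρ).1 (hP ρ hρ).2.1 (hP ρ hρ).2.2.1
  set mR : ℂ → ℝ := fun ρ ↦ (DirichletDisc.zeroOrder χ ρ : ℝ) with hmR
  have hmR0 : ∀ ρ ∈ P, 0 ≤ mR ρ := fun _ _ ↦ Nat.cast_nonneg _
  set Z : ℝ → ℂ := fun y ↦ ∑ ρ ∈ P, (mR ρ : ℂ) * ((y : ℂ) ^ (ρ - t * I) / (ρ - t * I)) with hZ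
  set S₃ : ℝ → ℂ := fun y ↦ ∑ n ∈ Finset.Ioc 2 ⌊y⌋₊, χ n * Λ n * (n : ℂ) ^ (-(t * I)) with hS₃
  -- Step A: the pointwise bound on `[x, x + s] × [9/4, 11/4]`
  set L₂ := Real.log (q * (2 * x) * T) with hL₂
  set Bx : ℝ := (2 * K + 3) * Real.log (2 * x) + 2 * K * (2 * x / T) * L₂ ^ 2 +
    |t| * K * (4 * (2 * x) * Real.log (2 * x) / Real.sqrt (2 * T) + 2 * x * L₂ ^ 2 / T) with hBx
  have hsx : s ≤ x := by nlinarith [Real.mul_self_sqrt hx0.le]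
  have hA : ∀ X ∈ Icc x (x + s), ∀ c ∈ Icc (9 / 4 : ℝ) (11 / 4), ‖S₃ x + Z X - Z c‖ ≤
      Bx + (s + 1) * Real.log (2 * x) := by
    intro X hX c hc
    have hX3 : 3 ≤ X := by linarith [hX.1]
    have hX0 : 0 < X := by linarith
    have hX2x : X ≤ 2 * x := by linarith [hX.2]
    have h3 := norm_twistedSum_add_zeroSums_le hK0 hEF hprim hq t hc.1 hc.2 hX3 hT2
    have hZd : ∑ ρ ∈ (lfunctionZeroBox_finite (ne_one_of_isPrimitive hprim hq) T).toFinset,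
        (DirichletDisc.zeroOrder χ ρ : ℂ) * (((X : ℂ) ^ (ρ - t * I) - (c : ℂ) ^ (ρ - t * I)) / (ρ - t * I)) =
        Z X - Z c := by
      simp only [hZ, hmR, sub_div, mul_sub, Finset.sum_sub_distrib, Complex.ofReal_natCast, hPdef]
    rw [hZd] at h3
    -- monotonicity of the bound in `X ≤ 2x`, `c ≥ 9/4 ≥ 2`
    have hlogX : Real.log X ≤ Real.log (2 * x) := Real.log_le_log hX0 hX2x
    have hlogX0 : 0 ≤ Real.log X := Real.log_nonneg (by linarith)
    have hT1 : (1 : ℝ) ≤ T := by linarith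
    have hqX : (1 : ℝ) ≤ q * X := one_le_mul_of_one_le_of_one_le (by linarith) (by linarith)
    have hLX0 : 0 ≤ Real.log (q * X * T) := Real.log_nonneg (one_le_mul_of_one_le_of_one_le hqX hT1)
    have hLX : Real.log (q * X * T) ≤ L₂ :=
      Real.log_le_log (by positivity) (mul_le_mul_of_nonneg_right
        (mul_le_mul_of_nonneg_left hX2x (by linarith)) hT0)
    have hL₂0 : 0 ≤ L₂ := hLX0.trans hLX
    have hsq : Real.log (q * X * T) ^ 2 ≤ L₂ ^ 2 := pow_le_pow_left₀ hLX0 hLX 2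
    have hcT : Real.sqrt (2 * T) ≤ Real.sqrt (c * T) := Real.sqrt_le_sqrt (by nlinarith [hc.1])
    have hsT0 : 0 < Real.sqrt (2 * T) := Real.sqrt_pos.2 (by linarith)
    have hb1 : (2 * K + 3) * Real.log X ≤ (2 * K + 3) * Real.log (2 * x) :=
      mul_le_mul_of_nonneg_left hlogX (by positivity)
    have hb2 : 2 * K * (X / T) * Real.log (q * X * T) ^ 2 ≤ 2 * K * (2 * x / T) * L₂ ^ 2 :=
      mul_le_mul (mul_le_mul_of_nonneg_left (div_le_div_of_nonneg_right hX2x hT0) (by positivity))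
        hsq (sq_nonneg _) (by positivity)
    have hb3 : 4 * X * Real.log X / Real.sqrt (c * T) ≤ 4 * (2 * x) * Real.log (2 * x) / Real.sqrt (2 * T) :=
      div_le_div₀ (by have := Real.log_nonneg (by linarith : (1 : ℝ) ≤ 2 * x); positivity)
        (mul_le_mul (by linarith) hlogX hlogX0 (by positivity)) hsT0 hcT
    have hb4 : X * Real.log (q * X * T) ^ 2 / T ≤ 2 * x * L₂ ^ 2 / T :=
      div_le_div_of_nonneg_right (mul_le_mul hX2x hsq (sq_nonneg _) (by positivity)) hT0
    have hb34 : |t| * K * (4 * X * Real.log X / Real.sqrt (c * T) + X * Real.log (q * X * T) ^ 2 / T) ≤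
        |t| * K * (4 * (2 * x) * Real.log (2 * x) / Real.sqrt (2 * T) + 2 * x * L₂ ^ 2 / T) :=
      mul_le_mul_of_nonneg_left (add_le_add hb3 hb4) (by positivity)
    -- the short interval `S₃ X − S₃ x`
    have hfl : ⌊x⌋₊ ≤ ⌊X⌋₊ := Nat.floor_le_floor hX.1
    have hfl2 : 2 ≤ ⌊x⌋₊ := Nat.le_floor (by norm_num; linarith)
    have hshort : ‖S₃ X - S₃ x‖ ≤ (s + 1) * Real.log (2 * x) := by
      have e : S₃ X - S₃ x = ∑ n ∈ Finset.Ioc ⌊x⌋₊ ⌊X⌋₊, χ n * Λ n * (n : ℂ) ^ (-(t * I)) := by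
        rw [hS₃]; dsimp only
        rw [← Finset.sum_Ioc_consecutive _ hfl2 hfl]; ring
      rw [e]
      refine (norm_sum_Ioc_twist_le χ t hfl).trans ?_
      have h1 : (⌊X⌋₊ : ℝ) - ⌊x⌋₊ ≤ s + 1 := by
        have := Nat.floor_le hX0.le; have := Nat.lt_floor_add_one x; linarith [hX.2]
      have hflX : (16 : ℝ) ≤ ⌊X⌋₊ := by
        have : (16 : ℕ) ≤ ⌊X⌋₊ := Nat.le_floor (by norm_num; linarith [hX.1])
        exact_mod_cast this
      have h2 : Real.log (⌊X⌋₊ : ℕ) ≤ Real.log (2 * x) :=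
        (Real.log_le_log (by linarith) (Nat.floor_le hX0.le)).trans hlogX
      have h20 : 0 ≤ Real.log (⌊X⌋₊ : ℕ) := Real.log_nonneg (by linarith)
      exact mul_le_mul h1 h2 h20 (by linarith)
    calc ‖S₃ x + Z X - Z c‖ = ‖(S₃ X + (Z X - Z c)) - (S₃ X - S₃ x)‖ := by ring_nf
      _ ≤ ‖S₃ X + (Z X - Z c)‖ + ‖S₃ X - S₃ x‖ := norm_sub_le _ _
      _ ≤ Bx + (s + 1) * Real.log (2 * x) := add_le_add (h3.trans (by rw [hBx]; linarith)) hshort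
  -- Step B: average over `c ∈ [9/4, 11/4]`
  set avc : ℂ := (((11 / 4 : ℝ) - 9 / 4)⁻¹ : ℝ) * ∫ y in (9 / 4 : ℝ)..(11 / 4), Z y with havc
  have hB : ∀ X ∈ Icc x (x + s), ‖S₃ x - avc + Z X‖ ≤ Bx + (s + 1) * Real.log (2 * x) := by
    intro X hX
    have h := norm_add_avg_le (S := S₃ x + Z X) (g := fun y ↦ -Z y) (a := 9 / 4) (b := 11 / 4)
      (B := Bx + (s + 1) * Real.log (2 * x)) (by norm_num)
      ((continuousOn_zeroSum P _ t (by norm_num)).neg)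
      (fun c hc ↦ by simpa only [sub_eq_add_neg] using hA X hX c hc)
    rw [intervalIntegral.integral_neg, mul_neg, ← sub_eq_add_neg] at h
    rwa [show S₃ x - avc + Z X = S₃ x + Z X - avc by ring]
  -- Step C: average over `X ∈ [x, x + s]`
  have hC := norm_add_avg_le (S := S₃ x - avc) (g := Z) (B := Bx + (s + 1) * Real.log (2 * x))
    (show x < x + s by linarith) (continuousOn_zeroSum P _ t hx0) hB
  rw [add_sub_cancel_left] at hC
  -- Steps D, E: the averaged zero sums are damped window sums
  have hD := norm_avg_zeroSum_Icc_le P hmR0 hPre t hx1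
  have hE := norm_avg_zeroSum_c_le P hmR0 hPre t
  have hs1 : 1 ≤ s := by linarith
  have hsum1 := hC₂ q χ hprim hq hRH t T s⁻¹ hT0 (inv_pos.2 hs0) (inv_le_one_of_one_le₀ hs1) P hP
  have hsum2 := hC₂ q χ hprim hq hRH t T 1 hT0 one_pos le_rfl P hP
  have hnX : ‖((s⁻¹ : ℝ) : ℂ) * ∫ y in x..x + s, Z y‖ ≤ 4 * Real.sqrt 2 * s *
      (C₂ * (Real.log q + Real.log (2 * |t| + T + 5)) * (1 + Real.log (1 + 1 / s⁻¹))) :=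
    hD.trans (mul_le_mul_of_nonneg_left hsum1 (by positivity))
  have hnc : ‖avc‖ ≤ 31 * (C₂ * (Real.log q + Real.log (2 * |t| + T + 5)) * (1 + Real.log (1 + 1 / 1))) :=
    hE.trans (mul_le_mul_of_nonneg_left hsum2 (by norm_num))
  -- `S x = S₃ x + (n ≤ 2 terms)`
  have hN2 : 2 ≤ ⌊x⌋₊ := Nat.le_floor (by norm_num; linarith)
  have hS : ‖∑ n ∈ Finset.range (⌊x⌋₊ + 1), χ n * Λ n * (n : ℂ) ^ (-(t * I))‖ ≤ ‖S₃ x‖ + Real.log 2 := by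
    have h := norm_sum_range_sub_sum_Ioc_le χ t hN2
    have e := norm_add_le (∑ n ∈ Finset.range (⌊x⌋₊ + 1), χ n * Λ n * (n : ℂ) ^ (-(t * I)) - S₃ x) (S₃ x)
    rw [sub_add_cancel] at e
    linarith
  have h₃ : ‖S₃ x‖ ≤ (Bx + (s + 1) * Real.log (2 * x)) + ‖avc‖ + ‖((s⁻¹ : ℝ) : ℂ) * ∫ y in x..x + s, Z y‖ := by
    have e1 := norm_sub_le (S₃ x - avc + ((s⁻¹ : ℝ) : ℂ) * ∫ y in x..x + s, Z y)
      (((s⁻¹ : ℝ) : ℂ) * ∫ y in x..x + s, Z y)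
    have e2 := norm_add_le (S₃ x - avc) avc
    rw [add_sub_cancel_right] at e1
    rw [sub_add_cancel] at e2
    linarith
  have hBx := pointwiseBound_le (t := t) hK0 hq2 hx16 hT
  have hℒ := windowLog_le (t := t) hq2 hx16 hT
  exact norm_twistedPsi_arith hK0 hC₂0.le hq2 hx16 hℒ hS (by linarith only [h₃, hBx]) hnc hnX

end GRHTwistedPrimeSum

end Literature.NumberTheory.LFunctions
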